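import Summits.HubbardSuperconductivity.HubbardSuperconductivity.Theorems.BalabanIRBirComplexStableXYRStubLinearPartSector
import HarnessLib

/-!
# Crux `BirComplexStableXYR` (stmt-HubbardSuperconductivity-14845), line `fat-gaussian-defect-calculus`:
# stub D1 `stub_berryPhaseFactor` — Berry-phase factorisation of the local factors

Helper (`--supports`) for the crux
`Summit.HubbardSuperconductivity.HubbardSuperconductivity.Theses.BalabanIR.BirComplexStableXYR`, line
`fat-gaussian-defect-calculus` (lead skeleton `Cruxes/BirComplexStableXYR/Lines/fat_gaussian_defect_calculus.lean`),
registered stub D1 `stub_berryPhaseFactor` (chapter 2, wave 7).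

**Statement.** In the landed Fröhlich–Spencer representation the sector integrand carries the product of local
window factors `Π_s R_s(P_s η)` with `R_s(u) = exp(−K·genF c u + (K/2)·Q u)` and `η = d₀φ − σ`.  Splitting off the
LINEAR (purely imaginary) part `i·m·u`, `m·u = Σ_w m_w u_w`, of each window weight,
`Π_s R_s(P_s η) = e^{+iK Σ_s m·P_s σ} · Π_s R̃_s(P_s η)` with the REDUCED factor
`R̃_s(u) = exp(−K(genF c u − i·m·u) + (K/2)·Q u)`.

**Proof.** Pure algebra plus the landed stub C8 `stub_linearPartSector`.  Window by window
`R̃_s(u) = R_s(u) · e^{iK m·u}` (`Complex.exp_add`), so `Π_s R̃_s(P_s η) = Π_s R_s(P_s η) · e^{iK Σ_s m·P_s η}`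
(`Finset.prod_mul_distrib`, `Complex.exp_sum`), and by C8 the translate-sum of the linear part only sees the sector,
`Σ_s m·P_s η = −Σ_s m·P_s σ`; the two phases cancel.  No definitions; sorry-free; Mathlib only. [folklore]
-/

set_option linter.dupNamespace false -- `Summit.<S>.<S>.Theorems…` repeats the summit name (D-0017 layout)

noncomputable section

namespace Summit.HubbardSuperconductivity.HubbardSuperconductivity.Theorems.FSUnfolding

open scoped BigOperators
open Literature.MathematicalPhysics.QuantumFieldTheory Literature.Probability.LatticeModels
open Summit.HubbardSuperconductivity.BirComplexStableXYNegative

/-- **One reduced factor is the full factor times its linear phase**: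
`exp(−K(G − i·ℓ) + q) = exp(−K·G + q) · exp(K·i·ℓ)` (`Complex.exp_add`; exponents agree by `ring`). [folklore] -/
theorem berryPhase_factor_split (K : ℝ) (G : ℂ) (q ℓ : ℝ) :
    Complex.exp (-((K : ℂ) * (G - Complex.I * (ℓ : ℂ))) + (q : ℂ)) =
      Complex.exp (-((K : ℂ) * G) + (q : ℂ)) * Complex.exp ((K : ℂ) * Complex.I * (ℓ : ℂ)) := by
  rw [← Complex.exp_add]
  congr 1
  ring

/-- **The product of the linear phases is the phase of the summed linear parts**:
`Π_s exp(K·i·ℓ_s) = exp(K·i·(−T))` whenever `Σ_s ℓ_s = −T` (`Complex.exp_sum`, `Finset.mul_sum`,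
`Complex.ofReal_sum`). [folklore] -/
theorem berryPhase_prod_phase {ι : Type*} (S : Finset ι) (K : ℝ) (ℓ : ι → ℝ) (T : ℝ)
    (hT : ∑ s ∈ S, ℓ s = -T) :
    ∏ s ∈ S, Complex.exp ((K : ℂ) * Complex.I * (ℓ s : ℂ)) =
      Complex.exp ((K : ℂ) * Complex.I * ((-T : ℝ) : ℂ)) := by
  rw [← Complex.exp_sum, ← Finset.mul_sum, ← Complex.ofReal_sum, hT]

/-- **The two sector phases cancel**: `exp(i·(K·T)) · exp(K·i·(−T)) = 1`. [folklore] -/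
theorem berryPhase_phases_cancel (K T : ℝ) :
    Complex.exp (Complex.I * ((K * T : ℝ) : ℂ)) * Complex.exp ((K : ℂ) * Complex.I * ((-T : ℝ) : ℂ)) = 1 := by
  rw [← Complex.exp_add]
  have h0 : Complex.I * ((K * T : ℝ) : ℂ) + (K : ℂ) * Complex.I * ((-T : ℝ) : ℂ) = 0 := by
    push_cast
    ring
  rw [h0, Complex.exp_zero]

/-- **Abstract Berry-phase factorisation.**  For any finite family of weights `G_s : ℂ`, real quadratic parts `q_s`,
real linear parts `ℓ_s` with `Σ_s ℓ_s = −T`: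
`Π_s exp(−K·G_s + q_s) = exp(i·K·T) · Π_s exp(−K(G_s − i·ℓ_s) + q_s)`. [folklore] -/
theorem berryPhase_prod_factor {ι : Type*} (S : Finset ι) (K : ℝ) (G : ι → ℂ) (q ℓ : ι → ℝ) (T : ℝ)
    (hT : ∑ s ∈ S, ℓ s = -T) :
    ∏ s ∈ S, Complex.exp (-((K : ℂ) * G s) + (q s : ℂ)) =
      Complex.exp (Complex.I * ((K * T : ℝ) : ℂ)) *
        ∏ s ∈ S, Complex.exp (-((K : ℂ) * (G s - Complex.I * (ℓ s : ℂ))) + (q s : ℂ)) := by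
  have hfac : ∀ s ∈ S, Complex.exp (-((K : ℂ) * (G s - Complex.I * (ℓ s : ℂ))) + (q s : ℂ)) =
      Complex.exp (-((K : ℂ) * G s) + (q s : ℂ)) * Complex.exp ((K : ℂ) * Complex.I * (ℓ s : ℂ)) :=
    fun s _ => berryPhase_factor_split K (G s) (q s) (ℓ s)
  rw [Finset.prod_congr rfl hfac, Finset.prod_mul_distrib, berryPhase_prod_phase S K ℓ T hT,
    mul_left_comm, berryPhase_phases_cancel, mul_one]

/-- **Stub D1 `stub_berryPhaseFactor` (registered signature, verbatim): Berry-phase factorisation of the local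
factors.**  Splitting off the linear part `i·m·u` of each window weight,
`Π_s R_s(P_s(d₀φ − σ)) = e^{+iK Σ_s m·P_s σ} · Π_s R̃_s(P_s(d₀φ − σ))` with the REDUCED factor
`R̃_s(u) = exp(−K(genF c u − i m·u) + (K/2)Q u)`: the phase is a sector constant (`stub_linearPartSector`, landed C8),
independent of the spin wave.  Proof: `berryPhase_prod_factor` with `G_s = genF c (P_s η)`, `q_s = (K/2)·Q(P_s η)`,
`ℓ_s = Σ_w m_w (P_s η)_w`, `T = Σ_s Σ_w m_w (P_s σ)_w`, and `Σ_s ℓ_s = −T` by C8. [folklore] -/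
theorem stub_berryPhaseFactor :
    ∀ (r : ℕ) (K : ℝ) (c : Table r) (L M : ℕ) [NeZero L] [NeZero M]
      (P : (Λ L M → Fin 3 → ℝ) → Λ L M → W r → ℝ),
      (∀ (ω : Λ L M → Fin 3 → ℝ) (s : Λ L M) (w : W r), P ω s w =
        (TorusChart.piProdZMod 2 L M).lineSum ω 0 (w.1 : ℕ) s
          + (TorusChart.piProdZMod 2 L M).lineSum ω 1 (w.2.1 : ℕ) (s + (w.1 : ℕ) • (TorusChart.piProdZMod 2 L M).gen 0)
          + (TorusChart.piProdZMod 2 L M).lineSum ω 2 (w.2.2 : ℕ)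
            (s + (w.1 : ℕ) • (TorusChart.piProdZMod 2 L M).gen 0 + (w.2.1 : ℕ) • (TorusChart.piProdZMod 2 L M).gen 1)) →
      ∀ (Q : (W r → ℝ) → ℝ) (m : W r → ℝ) (φ : Λ L M → ℝ) (σ : Λ L M → Fin 3 → ℝ),
        ∏ s : Λ L M, Complex.exp
            (-((K : ℂ) * genF c (P (fun x i => (TorusChart.piProdZMod 2 L M).d₀ φ x i - σ x i) s))
              + (((K / 2 * Q (P (fun x i => (TorusChart.piProdZMod 2 L M).d₀ φ x i - σ x i) s)) : ℝ) : ℂ)) =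
          Complex.exp (Complex.I * (((K * ∑ s : Λ L M, ∑ w : W r, m w * P σ s w) : ℝ) : ℂ)) *
          ∏ s : Λ L M, Complex.exp
            (-((K : ℂ) * (genF c (P (fun x i => (TorusChart.piProdZMod 2 L M).d₀ φ x i - σ x i) s)
                - Complex.I * ((∑ w : W r, m w * P (fun x i => (TorusChart.piProdZMod 2 L M).d₀ φ x i - σ x i) s w : ℝ) : ℂ)))
              + (((K / 2 * Q (P (fun x i => (TorusChart.piProdZMod 2 L M).d₀ φ x i - σ x i) s)) : ℝ) : ℂ)) := by
  intro r K c L M _ _ P hP Q m φ σ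
  exact berryPhase_prod_factor Finset.univ K
    (fun s => genF c (P (fun x i => (TorusChart.piProdZMod 2 L M).d₀ φ x i - σ x i) s))
    (fun s => K / 2 * Q (P (fun x i => (TorusChart.piProdZMod 2 L M).d₀ φ x i - σ x i) s))
    (fun s => ∑ w : W r, m w * P (fun x i => (TorusChart.piProdZMod 2 L M).d₀ φ x i - σ x i) s w)
    (∑ s : Λ L M, ∑ w : W r, m w * P σ s w)
    (stub_linearPartSector r L M P hP m φ σ)

end Summit.HubbardSuperconductivity.HubbardSuperconductivity.Theorems.FSUnfolding

end
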